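import Mathlib
import Summits.PneNP.PneNP.Theorems.ConvexRankGatesConvexGateBlindNearTransversal

/-!
# PneNP / ConvexRankGates — `ConvexGateBlind`: conditional positivity of clique-non-negative weightings (matrix form)

Helpers (`--supports stmt-PneNP-10680`), COLUMN-SPACE line (prover seat 2, session 16): the REALISATION LEMMA behind the
second-generation catch bound.

Let `V` be a symmetric zero-diagonal matrix on `Fin m` (the edge weighting `v{x,y} = V x y` of the line) which is
`k`-CLIQUE-NON-NEGATIVE: `∑_{x,y ∈ Q} V x y ≥ 0` for every `k`-set `Q`. Fix ANY vertex set `H` ("hubs") with complement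
`S = Hᶜ` of size `s ≥ k`, and write

  `T₀ = ½ ∑_{x,y ∈ S} V x y`  (mass inside `S`),   `T₁(a) = ∑_{y ∈ S} V a y`  (mass from `a ∈ H` into `S`),
  `mass_out = T₀ + ∑_{a ∈ H} T₁(a) = ½∑∑ V − ½∑_{H×H} V`   (mass of the pairs NOT inside `H`),
  `neg_H = ½ ∑_{a,b ∈ H} max(−V a b, 0)`  (negative mass inside `H`).

The averaged validity inequalities of `…NearTransversal.lean`, normalised (`linkMass_ge`, `entry_ge`):

  (I0) `T₀ ≥ 0`,  (I1) `T₁(a) + ((k−2)/(s−1))·T₀ ≥ 0`,  (I2) `V a b + ((k−2)/s)(T₁(a)+T₁(b)) + ((k−2)(k−3)/(s(s−1)))·T₀ ≥ 0`;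

summing (I2) over the negative pairs inside `H` and (I1) over `H` yields the main result

* `negMass_hub_le` — if `X := (k−2)·#H/(s−1) ≤ 1/2` then `neg_H ≤ X · mass_out`.

In probabilistic language: for every colouring `c_H` of `H`, `E[v(bich_c) | c_H] ≥ (1 − 1/q − X)·mass_out +
(positive bichromatic mass inside H) ≥ 0` — the conditional expectation of the bichromatic mass stays non-negative after
conditioning on ANY `#H ≲ m/(2k)` vertices (sharp up to the constant: for `#H > m/(k−1)` the planted weighting on a
monochromatic `H` violates it). This is what removes the hub-mass term from the session-13 argument
(`…NegCoverCatch.lean`). [new; elementary averaging]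
-/

set_option linter.dupNamespace false

namespace Summit.PneNP.PneNP.Theorems

open Finset

noncomputable section

variable {m k : ℕ}

/-! ## Normalised forms -/

/-- `(s−1)·C(s−2,j) = C(s−1,j+1)·(j+1)` for `2 ≤ s` (Pascal absorption), over `ℝ`. [folklore] -/
theorem cast_pred_mul_choose (s j : ℕ) (hs : 2 ≤ s) :
    ((s : ℝ) - 1) * (Nat.choose (s - 2) j : ℝ) = (Nat.choose (s - 1) (j + 1) : ℝ) * ((j : ℝ) + 1) := by
  obtain ⟨s', rfl⟩ : ∃ s', s = s' + 2 := ⟨s - 2, by omega⟩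
  have h := Nat.add_one_mul_choose_eq (s' ) j
  have h' : ((s' + 1 : ℕ) : ℝ) * ((s'.choose j : ℕ) : ℝ) = (((s' + 1).choose (j + 1) : ℕ) : ℝ) * ((j + 1 : ℕ) : ℝ) := by
    exact_mod_cast h
  simp only [Nat.add_sub_cancel, show s' + 2 - 1 = s' + 1 by omega]
  push_cast at h' ⊢
  linarith

/-- `s·C(s−1,j) = C(s,j+1)·(j+1)` for `1 ≤ s`, over `ℝ`. [folklore] -/
theorem cast_mul_choose_pred (s j : ℕ) (hs : 1 ≤ s) :
    (s : ℝ) * (Nat.choose (s - 1) j : ℝ) = (Nat.choose s (j + 1) : ℝ) * ((j : ℝ) + 1) := by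
  obtain ⟨s', rfl⟩ : ∃ s', s = s' + 1 := ⟨s - 1, by omega⟩
  have h := Nat.add_one_mul_choose_eq s' j
  have h' : ((s' + 1 : ℕ) : ℝ) * ((s'.choose j : ℕ) : ℝ) = (((s' + 1).choose (j + 1) : ℕ) : ℝ) * ((j + 1 : ℕ) : ℝ) := by
    exact_mod_cast h
  simp only [Nat.add_sub_cancel]
  push_cast at h' ⊢
  linarith

/-- **(I1), normalised.** With `s = #S ≥ k ≥ 4`, `a ∉ S`, `T₀ = ½∑_{S×S} V`, `T₁(a) = ∑_{y∈S} V a y`: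
`T₁(a) ≥ −((k−2)/(s−1))·T₀`. [new; elementary] -/
theorem linkMass_ge (V : Fin m → Fin m → ℝ) (hV : ∀ x y, V x y = V y x) (hV0 : ∀ x, V x x = 0) (hk : 4 ≤ k)
    (hvalid : ∀ Q ∈ (Finset.univ : Finset (Fin m)).powersetCard k, 0 ≤ ∑ x ∈ Q, ∑ y ∈ Q, V x y)
    (S : Finset (Fin m)) (hS : k ≤ S.card) {a : Fin m} (ha : a ∉ S) :
    -(((k : ℝ) - 2) / ((S.card : ℝ) - 1)) * ((∑ x ∈ S, ∑ y ∈ S, V x y) / 2) ≤ ∑ y ∈ S, V a y := by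
  have h := sum_valid_insert V hV hV0 (by omega) hvalid S ha
  have hs2 : 2 ≤ S.card := by omega
  have hs1 : (1 : ℝ) < S.card := by exact_mod_cast (show 1 < S.card by omega)
  -- `(s-1)·C(s-2,k-3) = C(s-1,k-2)·(k-2)`
  have hid := cast_pred_mul_choose S.card (k - 3) hs2
  have hk3 : k - 3 + 1 = k - 2 := by omega
  rw [hk3] at hid
  have hkR : (((k - 3 : ℕ) : ℝ) + 1) = (k : ℝ) - 2 := by
    have : ((k - 3 : ℕ) : ℝ) = (k : ℝ) - 3 := by
      rw [Nat.cast_sub (by omega)]; norm_num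
    rw [this]; ring
  rw [hkR] at hid
  have hCpos : (0 : ℝ) < (Nat.choose (S.card - 1) (k - 2) : ℝ) := by
    exact_mod_cast Nat.choose_pos (by omega)
  set C1 : ℝ := (Nat.choose (S.card - 1) (k - 2) : ℝ) with hC1
  set A : ℝ := ∑ x ∈ S, ∑ y ∈ S, V x y with hA
  set B : ℝ := ∑ y ∈ S, V a y with hB
  -- substitute `C(s-2,k-3) = C1 (k-2)/(s-1)` into `h`
  have hT : (Nat.choose (S.card - 2) (k - 3) : ℝ) = C1 * ((k : ℝ) - 2) / ((S.card : ℝ) - 1) := by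
    rw [eq_div_iff (by linarith)]; linarith
  rw [hT] at h
  have h' : 0 ≤ C1 * (((k : ℝ) - 2) / ((S.card : ℝ) - 1) * A + 2 * B) := by
    have e : C1 * ((k : ℝ) - 2) / ((S.card : ℝ) - 1) * A + 2 * C1 * B =
        C1 * (((k : ℝ) - 2) / ((S.card : ℝ) - 1) * A + 2 * B) := by ring
    rw [e] at h; exact h
  have h'' : 0 ≤ ((k : ℝ) - 2) / ((S.card : ℝ) - 1) * A + 2 * B :=
    nonneg_of_mul_nonneg_right h' hCpos
  have e2 : -(((k : ℝ) - 2) / ((S.card : ℝ) - 1)) * (A / 2) = -((((k : ℝ) - 2) / ((S.card : ℝ) - 1)) * A) / 2 := by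
    ring
  rw [e2]
  linarith

/-- **(I2), normalised.** With `s = #S ≥ k ≥ 4`, `a ≠ b` outside `S`:
`V a b ≥ −((k−2)/s)·(T₁(a) + T₁(b)) − ((k−2)(k−3)/(s(s−1)))·T₀`. [new; elementary] -/
theorem entry_ge (V : Fin m → Fin m → ℝ) (hV : ∀ x y, V x y = V y x) (hV0 : ∀ x, V x x = 0) (hk : 4 ≤ k)
    (hvalid : ∀ Q ∈ (Finset.univ : Finset (Fin m)).powersetCard k, 0 ≤ ∑ x ∈ Q, ∑ y ∈ Q, V x y)
    (S : Finset (Fin m)) (hS : k ≤ S.card) {a b : Fin m} (ha : a ∉ S) (hb : b ∉ S) (hab : a ≠ b) :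
    -(((k : ℝ) - 2) / (S.card : ℝ)) * (∑ y ∈ S, V a y + ∑ y ∈ S, V b y) -
        (((k : ℝ) - 2) * ((k : ℝ) - 3) / ((S.card : ℝ) * ((S.card : ℝ) - 1))) * ((∑ x ∈ S, ∑ y ∈ S, V x y) / 2) ≤
      V a b := by
  have h := sum_valid_insert_insert V hV hV0 hk hvalid S ha hb hab
  have hs2 : 2 ≤ S.card := by omega
  have hs1 : (1 : ℝ) < S.card := by exact_mod_cast (show 1 < S.card by omega)
  have hs0 : (0 : ℝ) < S.card := by linarith
  -- `s·C(s-1,k-3) = C(s,k-2)·(k-2)` and `(s-1)·C(s-2,k-4) = C(s-1,k-3)·(k-3)`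
  have hidA := cast_mul_choose_pred S.card (k - 3) (by omega)
  have hidB := cast_pred_mul_choose S.card (k - 4) hs2
  have hk3 : k - 3 + 1 = k - 2 := by omega
  have hk4 : k - 4 + 1 = k - 3 := by omega
  rw [hk3] at hidA
  rw [hk4] at hidB
  have hkR3 : (((k - 3 : ℕ) : ℝ) + 1) = (k : ℝ) - 2 := by
    have : ((k - 3 : ℕ) : ℝ) = (k : ℝ) - 3 := by rw [Nat.cast_sub (by omega)]; norm_num
    rw [this]; ring
  have hkR4 : (((k - 4 : ℕ) : ℝ) + 1) = (k : ℝ) - 3 := by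
    have : ((k - 4 : ℕ) : ℝ) = (k : ℝ) - 4 := by rw [Nat.cast_sub (by omega)]; norm_num
    rw [this]; ring
  rw [hkR3] at hidA
  rw [hkR4] at hidB
  have hCpos : (0 : ℝ) < (Nat.choose S.card (k - 2) : ℝ) := by exact_mod_cast Nat.choose_pos (by omega)
  set C2 : ℝ := (Nat.choose S.card (k - 2) : ℝ) with hC2
  set A : ℝ := ∑ x ∈ S, ∑ y ∈ S, V x y with hA
  set Ba : ℝ := ∑ y ∈ S, V a y with hBa
  set Bb : ℝ := ∑ y ∈ S, V b y with hBb
  have hC3 : (Nat.choose (S.card - 1) (k - 3) : ℝ) = C2 * ((k : ℝ) - 2) / S.card := by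
    rw [eq_div_iff hs0.ne']; linarith
  have hC4 : (Nat.choose (S.card - 2) (k - 4) : ℝ) =
      C2 * ((k : ℝ) - 2) * ((k : ℝ) - 3) / (S.card * ((S.card : ℝ) - 1)) := by
    rw [eq_div_iff (by positivity)]
    have e1 : ((S.card : ℝ) - 1) * (Nat.choose (S.card - 2) (k - 4) : ℝ) =
        (Nat.choose (S.card - 1) (k - 3) : ℝ) * ((k : ℝ) - 3) := hidB
    rw [hC3] at e1
    have e2 : C2 * ((k : ℝ) - 2) / S.card * ((k : ℝ) - 3) * S.card = C2 * ((k : ℝ) - 2) * ((k : ℝ) - 3) := by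
      field_simp
    calc (Nat.choose (S.card - 2) (k - 4) : ℝ) * (S.card * ((S.card : ℝ) - 1))
        = (((S.card : ℝ) - 1) * (Nat.choose (S.card - 2) (k - 4) : ℝ)) * S.card := by ring
      _ = C2 * ((k : ℝ) - 2) / S.card * ((k : ℝ) - 3) * S.card := by rw [e1]
      _ = C2 * ((k : ℝ) - 2) * ((k : ℝ) - 3) := e2
  rw [hC3, hC4] at h
  have h' : 0 ≤ C2 * (((k : ℝ) - 2) * ((k : ℝ) - 3) / (S.card * ((S.card : ℝ) - 1)) * A +
      2 * (((k : ℝ) - 2) / S.card) * (Ba + Bb) + 2 * V a b) := by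
    have e : C2 * ((k : ℝ) - 2) * ((k : ℝ) - 3) / (S.card * ((S.card : ℝ) - 1)) * A +
        2 * (C2 * ((k : ℝ) - 2) / S.card) * (Ba + Bb) + 2 * C2 * V a b =
        C2 * (((k : ℝ) - 2) * ((k : ℝ) - 3) / (S.card * ((S.card : ℝ) - 1)) * A +
          2 * (((k : ℝ) - 2) / S.card) * (Ba + Bb) + 2 * V a b) := by ring
    rw [e] at h; exact h
  have h'' : 0 ≤ ((k : ℝ) - 2) * ((k : ℝ) - 3) / (S.card * ((S.card : ℝ) - 1)) * A +
      2 * (((k : ℝ) - 2) / S.card) * (Ba + Bb) + 2 * V a b :=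
    nonneg_of_mul_nonneg_right h' hCpos
  have e2 : -(((k : ℝ) - 2) / (S.card : ℝ)) * (Ba + Bb) -
        (((k : ℝ) - 2) * ((k : ℝ) - 3) / ((S.card : ℝ) * ((S.card : ℝ) - 1))) * (A / 2) =
      -((2 * (((k : ℝ) - 2) / S.card) * (Ba + Bb) +
        ((k : ℝ) - 2) * ((k : ℝ) - 3) / (S.card * ((S.card : ℝ) - 1)) * A) / 2) := by ring
  rw [e2]
  linarith

/-! ## The negative mass inside the hubs -/

/-- **Splitting the total mass at a vertex set.** For symmetric `V`:
`½∑∑ V − ½∑_{H×H} V = ½∑_{Hᶜ×Hᶜ} V + ∑_{a ∈ H} ∑_{y ∈ Hᶜ} V a y` (mass of the pairs not inside `H`). [folklore] -/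
theorem massOut_eq (V : Fin m → Fin m → ℝ) (hV : ∀ x y, V x y = V y x) (H : Finset (Fin m)) :
    (∑ x, ∑ y, V x y) / 2 - (∑ a ∈ H, ∑ b ∈ H, V a b) / 2 =
      (∑ x ∈ Hᶜ, ∑ y ∈ Hᶜ, V x y) / 2 + ∑ a ∈ H, ∑ y ∈ Hᶜ, V a y := by
  classical
  have hrow : ∀ x, ∑ y, V x y = ∑ y ∈ H, V x y + ∑ y ∈ Hᶜ, V x y := fun x =>
    (Finset.sum_add_sum_compl H _).symm
  have htot : ∑ x, ∑ y, V x y = ∑ x ∈ H, ∑ y, V x y + ∑ x ∈ Hᶜ, ∑ y, V x y :=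
    (Finset.sum_add_sum_compl H _).symm
  rw [htot, Finset.sum_congr rfl (fun x _ => hrow x), Finset.sum_congr rfl (fun x _ => hrow x),
    Finset.sum_add_distrib, Finset.sum_add_distrib]
  have hsym : ∑ x ∈ Hᶜ, ∑ y ∈ H, V x y = ∑ a ∈ H, ∑ y ∈ Hᶜ, V a y := by
    rw [Finset.sum_comm]
    exact Finset.sum_congr rfl fun a _ => Finset.sum_congr rfl fun y _ => hV y a
  rw [hsym]
  ring

/-- **Negative mass inside the hubs (realisation lemma).** Let `V` be symmetric with zero diagonal and
`k`-clique-non-negative (`4 ≤ k`), `H` a vertex set with `k ≤ #Hᶜ` and `X = (k−2)·#H/(#Hᶜ − 1) ≤ 1/2`. Then the negative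
mass inside `H` is at most `X` times the mass of the pairs not inside `H`:
`½∑_{a,b ∈ H} max(−V a b, 0) ≤ X · (½∑∑ V − ½∑_{H×H} V)`. (Sum (I2) over the negative pairs of `H`, bound the link masses
with (I1), and use (I0).) [new] -/
theorem negMass_hub_le (V : Fin m → Fin m → ℝ) (hV : ∀ x y, V x y = V y x) (hV0 : ∀ x, V x x = 0) (hk : 4 ≤ k)
    (hvalid : ∀ Q ∈ (Finset.univ : Finset (Fin m)).powersetCard k, 0 ≤ ∑ x ∈ Q, ∑ y ∈ Q, V x y)
    (H : Finset (Fin m)) (hS : k ≤ (Hᶜ).card)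
    (hX : ((k : ℝ) - 2) * H.card / (((Hᶜ).card : ℝ) - 1) ≤ 1 / 2) :
    (∑ a ∈ H, ∑ b ∈ H, max (-V a b) 0) / 2 ≤
      (((k : ℝ) - 2) * H.card / (((Hᶜ).card : ℝ) - 1)) * ((∑ x, ∑ y, V x y) / 2 - (∑ a ∈ H, ∑ b ∈ H, V a b) / 2) := by
  classical
  have hs1R : (1 : ℝ) < (Hᶜ).card := by exact_mod_cast (show 1 < (Hᶜ).card by omega)
  have hs0R : (0 : ℝ) < (Hᶜ).card := by linarith
  have hkR : (4 : ℝ) ≤ k := by exact_mod_cast hk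
  have hmemS : ∀ {a}, a ∈ H → a ∉ Hᶜ := fun ha => by rw [mem_compl]; exact not_not.2 ha
  -- notation for the masses and coefficients
  set T0 : ℝ := (∑ x ∈ Hᶜ, ∑ y ∈ Hᶜ, V x y) / 2 with hT0
  set T1 : Fin m → ℝ := fun a => ∑ y ∈ Hᶜ, V a y with hT1
  set c₁ : ℝ := ((k : ℝ) - 2) / (((Hᶜ).card : ℝ) - 1) with hc₁
  set c₂ : ℝ := ((k : ℝ) - 2) / ((Hᶜ).card : ℝ) with hc₂
  set c₃ : ℝ := ((k : ℝ) - 2) * ((k : ℝ) - 3) / (((Hᶜ).card : ℝ) * (((Hᶜ).card : ℝ) - 1)) with hc₃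
  set X : ℝ := ((k : ℝ) - 2) * H.card / (((Hᶜ).card : ℝ) - 1) with hXdef
  have hc₁0 : 0 ≤ c₁ := div_nonneg (by linarith) (by linarith)
  have hc₂0 : 0 ≤ c₂ := div_nonneg (by linarith) hs0R.le
  have hc₃0 : 0 ≤ c₃ := div_nonneg (by nlinarith) (by nlinarith)
  have hX0 : 0 ≤ X := div_nonneg (mul_nonneg (by linarith) (Nat.cast_nonneg _)) (by linarith)
  -- (I0): `T0 ≥ 0`
  have hT0nn : 0 ≤ T0 := by
    have h0 := sum_valid_powersetCard V hV0 (by omega) hvalid Hᶜ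
    have hC : (0 : ℝ) < (Nat.choose ((Hᶜ).card - 2) (k - 2) : ℝ) := by exact_mod_cast Nat.choose_pos (by omega)
    have := nonneg_of_mul_nonneg_right h0 hC
    rw [hT0]; linarith
  -- (I1): `T1 a ≥ -c₁ T0` for `a ∈ H`
  have hI1 : ∀ a ∈ H, -c₁ * T0 ≤ T1 a := fun a ha => linkMass_ge V hV hV0 hk hvalid Hᶜ hS (hmemS ha)
  -- (I2): `V a b ≥ -c₂ (T1 a + T1 b) - c₃ T0` for `a ≠ b` in `H`
  have hI2 : ∀ a ∈ H, ∀ b ∈ H, a ≠ b → -c₂ * (T1 a + T1 b) - c₃ * T0 ≤ V a b :=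
    fun a ha b hb hab => entry_ge V hV hV0 hk hvalid Hᶜ hS (hmemS ha) (hmemS hb) hab
  -- pointwise bound on the negative parts inside `H`
  have hpt : ∀ a ∈ H, ∀ b ∈ H, max (-V a b) 0 ≤ c₂ * (T1 a + c₁ * T0) + c₂ * (T1 b + c₁ * T0) + c₃ * T0 := by
    intro a ha b hb
    have ha' : 0 ≤ T1 a + c₁ * T0 := by linarith [hI1 a ha]
    have hb' : 0 ≤ T1 b + c₁ * T0 := by linarith [hI1 b hb]
    have hrhs : 0 ≤ c₂ * (T1 a + c₁ * T0) + c₂ * (T1 b + c₁ * T0) + c₃ * T0 := by positivity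
    refine max_le ?_ hrhs
    by_cases hab : a = b
    · subst hab; rw [hV0, neg_zero]; exact hrhs
    · have := hI2 a ha b hb hab
      have hcc : 0 ≤ c₂ * (c₁ * T0) := by positivity
      linarith
  -- sum over `H × H`
  have hsum : ∑ a ∈ H, ∑ b ∈ H, max (-V a b) 0 ≤
      2 * c₂ * H.card * (∑ a ∈ H, T1 a + H.card * (c₁ * T0)) + (H.card : ℝ) * H.card * (c₃ * T0) := by
    calc ∑ a ∈ H, ∑ b ∈ H, max (-V a b) 0
        ≤ ∑ a ∈ H, ∑ b ∈ H, (c₂ * (T1 a + c₁ * T0) + c₂ * (T1 b + c₁ * T0) + c₃ * T0) :=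
          Finset.sum_le_sum fun a ha => Finset.sum_le_sum fun b hb => hpt a ha b hb
      _ = ∑ a ∈ H, ((H.card : ℝ) * (c₂ * (T1 a + c₁ * T0)) + c₂ * ∑ b ∈ H, (T1 b + c₁ * T0) +
            (H.card : ℝ) * (c₃ * T0)) := by
          refine Finset.sum_congr rfl fun a _ => ?_
          rw [Finset.sum_add_distrib, Finset.sum_add_distrib, Finset.sum_const, Finset.sum_const, nsmul_eq_mul,
            nsmul_eq_mul, ← Finset.mul_sum]
      _ = (H.card : ℝ) * (c₂ * ∑ a ∈ H, (T1 a + c₁ * T0)) + (H.card : ℝ) * (c₂ * ∑ b ∈ H, (T1 b + c₁ * T0)) +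
            (H.card : ℝ) * ((H.card : ℝ) * (c₃ * T0)) := by
          rw [Finset.sum_add_distrib, Finset.sum_add_distrib, Finset.sum_const, Finset.sum_const, nsmul_eq_mul,
            nsmul_eq_mul, ← Finset.mul_sum, ← Finset.mul_sum]
      _ = 2 * c₂ * H.card * (∑ a ∈ H, T1 a + H.card * (c₁ * T0)) + (H.card : ℝ) * H.card * (c₃ * T0) := by
          rw [Finset.sum_add_distrib, Finset.sum_const, nsmul_eq_mul]
          ring
  -- compare with `X · mass_out`, `mass_out = T0 + ∑_a T1 a`
  have hmass : (∑ x, ∑ y, V x y) / 2 - (∑ a ∈ H, ∑ b ∈ H, V a b) / 2 = T0 + ∑ a ∈ H, T1 a := by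
    rw [massOut_eq V hV H]
  rw [hmass]
  -- the coefficient inequalities: `c₂ h ≤ X`, `c₁ h = X` and `h² c₃ ≤ X²`
  have hc₂X : c₂ * H.card ≤ X := by
    rw [hc₂, hXdef, div_mul_eq_mul_div, div_le_div_iff₀ hs0R (by linarith)]
    have : 0 ≤ ((k : ℝ) - 2) * H.card := mul_nonneg (by linarith) (Nat.cast_nonneg _)
    nlinarith
  have hc₁X : (H.card : ℝ) * c₁ = X := by rw [hc₁, hXdef]; ring
  have hc₃X : (H.card : ℝ) * H.card * c₃ ≤ X ^ 2 := by
    rw [hc₃, hXdef, div_pow]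
    rw [show (H.card : ℝ) * H.card * (((k : ℝ) - 2) * ((k : ℝ) - 3) / (((Hᶜ).card : ℝ) * (((Hᶜ).card : ℝ) - 1))) =
      ((H.card : ℝ) * H.card * (((k : ℝ) - 2) * ((k : ℝ) - 3))) / (((Hᶜ).card : ℝ) * (((Hᶜ).card : ℝ) - 1)) by ring]
    rw [div_le_div_iff₀ (by nlinarith) (by nlinarith)]
    have h0 : (0 : ℝ) ≤ (H.card : ℝ) * H.card := by positivity
    have h1 : ((k : ℝ) - 2) * ((k : ℝ) - 3) * (((Hᶜ).card : ℝ) - 1) ^ 2 ≤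
        ((k : ℝ) - 2) ^ 2 * (((Hᶜ).card : ℝ) * (((Hᶜ).card : ℝ) - 1)) := by
      have e : ((k : ℝ) - 2) ^ 2 * (((Hᶜ).card : ℝ) * (((Hᶜ).card : ℝ) - 1)) -
          ((k : ℝ) - 2) * ((k : ℝ) - 3) * (((Hᶜ).card : ℝ) - 1) ^ 2 =
          ((k : ℝ) - 2) * (((Hᶜ).card : ℝ) - 1) * (((k : ℝ) - 2) + (((Hᶜ).card : ℝ) - 1)) := by ring
      have : 0 ≤ ((k : ℝ) - 2) * (((Hᶜ).card : ℝ) - 1) * (((k : ℝ) - 2) + (((Hᶜ).card : ℝ) - 1)) := by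
        have h3 : (0 : ℝ) ≤ (k : ℝ) - 2 := by linarith
        have h4 : (0 : ℝ) ≤ ((Hᶜ).card : ℝ) - 1 := by linarith
        positivity
      linarith
    calc (H.card : ℝ) * H.card * (((k : ℝ) - 2) * ((k : ℝ) - 3)) * (((Hᶜ).card : ℝ) - 1) ^ 2
        = (H.card : ℝ) * H.card * ((((k : ℝ) - 2) * ((k : ℝ) - 3)) * (((Hᶜ).card : ℝ) - 1) ^ 2) := by ring
      _ ≤ (H.card : ℝ) * H.card * (((k : ℝ) - 2) ^ 2 * (((Hᶜ).card : ℝ) * (((Hᶜ).card : ℝ) - 1))) :=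
          mul_le_mul_of_nonneg_left h1 h0
      _ = (((k : ℝ) - 2) * H.card) ^ 2 * (((Hᶜ).card : ℝ) * (((Hᶜ).card : ℝ) - 1)) := by ring
  -- `∑_a T1 a ≥ -h c₁ T0 = -X T0`
  have hT1sum : -X * T0 ≤ ∑ a ∈ H, T1 a := by
    have := Finset.sum_le_sum fun a ha => hI1 a ha
    rw [Finset.sum_const, nsmul_eq_mul] at this
    rw [← hc₁X]; linarith
  -- assemble
  have hsum0 : 0 ≤ ∑ a ∈ H, T1 a + X * T0 := by linarith
  have key : ∑ a ∈ H, ∑ b ∈ H, max (-V a b) 0 ≤ 2 * X * (∑ a ∈ H, T1 a + X * T0) + X ^ 2 * T0 := by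
    calc ∑ a ∈ H, ∑ b ∈ H, max (-V a b) 0
        ≤ 2 * c₂ * H.card * (∑ a ∈ H, T1 a + H.card * (c₁ * T0)) + (H.card : ℝ) * H.card * (c₃ * T0) := hsum
      _ = 2 * (c₂ * H.card) * (∑ a ∈ H, T1 a + X * T0) + ((H.card : ℝ) * H.card * c₃) * T0 := by
          rw [← hc₁X]; ring
      _ ≤ 2 * X * (∑ a ∈ H, T1 a + X * T0) + X ^ 2 * T0 := by
          have h1 : 2 * (c₂ * H.card) * (∑ a ∈ H, T1 a + X * T0) ≤ 2 * X * (∑ a ∈ H, T1 a + X * T0) := by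
            have := mul_le_mul_of_nonneg_right hc₂X hsum0
            linarith
          have h2 : ((H.card : ℝ) * H.card * c₃) * T0 ≤ X ^ 2 * T0 := mul_le_mul_of_nonneg_right hc₃X hT0nn
          linarith
  -- `2X(∑T1 + X T0) + X² T0 ≤ 2X(T0 + ∑T1)` since `3X² T0 ≤ 2X T0` (`X ≤ 1/2`)
  have hfin : 2 * X * (∑ a ∈ H, T1 a + X * T0) + X ^ 2 * T0 ≤ 2 * (X * (T0 + ∑ a ∈ H, T1 a)) := by
    have hXT : 0 ≤ X * T0 := mul_nonneg hX0 hT0nn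
    have : 3 * X ^ 2 * T0 ≤ 2 * X * T0 := by nlinarith
    nlinarith
  linarith

/-- **Negative mass inside the hubs** (registered form of `negMass_hub_le`). [new] -/
theorem hub_negMass_le : ∀ {m k : ℕ} (V : Fin m → Fin m → ℝ), (∀ x y, V x y = V y x) → (∀ x, V x x = 0) → 4 ≤ k → (∀ Q ∈ (Finset.univ : Finset (Fin m)).powersetCard k, 0 ≤ ∑ x ∈ Q, ∑ y ∈ Q, V x y) → ∀ (H : Finset (Fin m)), k ≤ (Hᶜ).card → ((k : ℝ) - 2) * H.card / (((Hᶜ).card : ℝ) - 1) ≤ 1 / 2 → (∑ a ∈ H, ∑ b ∈ H, max (-V a b) 0) / 2 ≤ (((k : ℝ) - 2) * H.card / (((Hᶜ).card : ℝ) - 1)) * ((∑ x, ∑ y, V x y) / 2 - (∑ a ∈ H, ∑ b ∈ H, V a b) / 2) :=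
  fun V hV hV0 hk hvalid H hS hX => negMass_hub_le V hV hV0 hk hvalid H hS hX

end

end Summit.PneNP.PneNP.Theorems
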